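/-
Copyright (c) 2026 the pub-hodgecm-mathlib formalisation cell (harness21).  Prover seat hodgecm-mathlib-LH4-p12 (g9), req620 Track A «(D-RAM) FOUR-FRAME» squad
(STAGE-1b, row (2) of the piece `f_{T₊}`, the (β₂) road (R-36) «PURE-CELL LEDGER»; K6 desk LH4-p16 (g3) WORD #10 ∕ #13 «F1b-top: the top cell, both parities, in the TOP chart»;
the top-cell twin of LH4-p18 (g4)'s F1b ★ p864627 `…RowTowerCellPerCellValue`), 2026-09-05.
-/
import Summits.HodgeConjecture.HodgeConjecture.Theorems.F0P3cDyRamRowTowerCellPerCellValue         -- ★ F1b p864627 (LH4-p18 (g4)): §1 `v_coord_sub_coord_le_of_floor` BY NAME; brings ★ K6-0 p864195, ★ p864078, ★ p864148, ★ p864081, ★ `…ConeCellLedgerSizes`, ★ Lit `normSign_eq_of_near`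
import Summits.HodgeConjecture.HodgeConjecture.Theorems.F0P3cDyRamRowTowerTopVertexLetters         -- (this seat): `rowTower_topVertex_letters` (both parities, label at any near on-shell coordinate); brings ★ p864617 ED. 2 HEAD-W
import HarnessLib

/-!
# Crux `H413`, line LH4 «(D-RAM) FOUR-FRAME» — STAGE-1b, row (2), the (β₂) road (R-36), K6 road F1b-top: «THE PER-CELL VALUE OF THE TOP CELL OF A ROW TOWER» — ★ K6-0 HEAD′ (p864195)
# INSTANTIATED on the TOP window cell `(j, b)` (`b < j`, `j + b + d%2 ≤ jl`) of the live row `2b + d%2 = m`, BOTH parities, in the TOP chart (`|ξ₀| = exp(jl − m)`, `g = 0`) and in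
# ‹OFF.letter.v1›'s literal-set currency: `X(j,b)·#(Rd.filter LIT) = n(j,b)·(ω(−h_W)·Σ_{V ∈ (Rd.filter LIT).filter NX} ω(α₁ + γ₁V))`, `NX V :⟺ |μ_a + μ_b(R₀ + Vγ₀)| = |ϖ|^{2b+d%2}`

Cell `hodgecm-mathlib` (D-0151), FLOOR 0, crux item H413 = `stmt-HodgeConjecture-24833`, route of record `HCCMUnconditional`; squad F0∕P3c∕LH4; lane
`--supports stmt-HodgeConjecture-24833 --as helper` (count-neutral; pays NO tier-0 row).  THEOREMS ONLY (no `def`, no instance, no notation, no `sorry`, default heartbeats);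
★-only imports; states NO law; (β₂) stays a HYPOTHESIS.  Binders = ★ F1b p864627's with EXACTLY these deltas: row `hbm : 2 * b + d % 2 = m` (no parity letter); ONE added
dyadic letter `h2 : ¬ IsUnit (2 : 𝒪[E])` (‹CORE›'s `_h2`); cell `hbj : b < j` STRICT (`N ≥ 1`; the lone cell of an `N = 0` window is not read); TOP chart `{g} (hg1)` DROPPED,
`hcell : j + b + d % 2 ≤ jl`, `hξv : |ξ₀|·|jEϖ|^{jl} = |jEϖ|^{2b+d%2}` (`|μ_bγ₀| = |â|`: the digit term is as large as the main term); label letters `hα₁σ hγ₁σ`, `hγ₁1 : |γ₁| ≤ 1`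
(top chart: `|γ₁| = 1`), the UNIT LETTER `hαγ : ∀ V, σV = V → |V| ≤ 1 → NX V → |α₁ + γ₁V| = 1` (★ p864616 ED. 2 `exists_affineLabel_of_coords_onShell_unit`) and the ON-SHELL
dictionary `haff` (one inserted premise); precision letters `hrfloor hrR hr₀ hdeep` as F1b's and `hrtop : r ≤ |ϖ|^{2d−1}` REPLACING `hrγ` (label constancy ON the shell + NX constancy).
WHAT.  With `P₁ Λ`, `Q₁ Λ` := ‹OFF.letter.v1›'s two literal sets of the cell (shells `LatticeNearTransvShell ϖ (d % 2) m⋆ ∕ m_c`), `X(j,b)`, `n(j,b)`, `cell`, `LIT` as in ★ F1b: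
**`X(j,b) · #(Rd.filter LIT) = n(j,b) · (normSign σ (−h_W) · Σ_{V ∈ (Rd.filter LIT).filter NX} normSign σ (α₁ + γ₁·V))`** — ★ K6-0 HEAD′'s bytes with
`NX V := Valued.v (μa + μb * (R₀ + V * γ₀)) = Valued.v ϖ ^ (2 * b + d % 2)` (NOT `⊤`: on the top cell the shell conjunct SELECTS the digits ON the shell) and
`ψ V := NX V → normSign σ (α₁ + γ₁·V) = normSign σ (−h_W)` (the label guarded by the shell — off the shell `α₁ + γ₁V` has a zero in the digit disc and no constancy).
MECHANISM: ★ F1b's, with THE JUNCTION reading (this seat's) `rowTower_topVertex_letters`: per glued vertex over a weighted member, presentation `(x₁, V₁)`, any generator's coordinate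
`Ve` with `|Ve − V₁| ≤ r` (★ F1b §1): `Shell(d%2, M) ↔ NX V₁ ↔ NX Ve` (ultrametric: `|μ_bγ₀|·r ≤ |ϖ|^{2b+d%2}·|ϖ|^{2d−1} < |â|`), and ON the shell `VS = X₊ ↔ ω(pw·P)·ω(α₁ + γ₁Ve) = 1`
(HEAD-W at `W := Ve`, `|μ_bγ₀|·|Ve − V₁| ≤ |ϖ|^{2b+m⋆}`) `↔ ω(α₁ + γ₁Ve) = ω(−h_W)` (★ p863914 §3 population constant); (hNX) = the same ultrametric constancy; (hψ) = on the shell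
★ Lit `normSign_eq_of_near` via `hαγ`, off the shell vacuous; sign read `hω` under NX = ★ `ite_eq_normSign_mul_normSign`.
So ONE theorem serves ‹CORE-ODD›'s boundary cell (`d` odd, `j + b + 1 = jl`) AND ‹CORE-3›'s terminal cell (`d` even, `j + b = jl`); the spine's top summand is the NX-sphere sum
((g-top) ★ p864688 `sum_normSign_affine_topSphere_eq_zero`, LH4-p08).
WHAT IS NOT CLAIMED: any digit-range bookkeeping, any character-sum value, any census identity, the `N = 0` window; ‹CORE-3›∕‹CORE-ODD› stay OPEN.
HONEST LABEL.  Count-neutral assembly of ★ pieces; nothing printed is asserted; no census law is stated; `HC_CM` is proved only modulo the 7 printed citations (2 remaining named inputs: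
hLiu418 = `stmt-HodgeConjecture-24832`, h413 = `stmt-HodgeConjecture-24833`) until rung 0 closes.
## References
* [Kottwitz1986BaseChangeUnits] R. E. Kottwitz, *Base change for unit elements of Hecke algebras*, Compositio Math. 60 (1986): §1 pp. 240–241 (signed lattice counts cell by cell).
* [LabesseLanglands1979] J.-P. Labesse, R. P. Langlands, *L-indistinguishability for SL(2)*, Canad. J. Math. 31 (1979): §2 (2.2) p. 9 (κ-signed counts).
* [Rogawski1990] J. D. Rogawski, *Automorphic Representations of Unitary Groups in Three Variables*, Ann. of Math. Stud. 123 (1990): §4.9 Prop. 4.9.1 (b) p. 55.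
* [Serre1979] J.-P. Serre, *Local Fields*, GTM 67 (1979): Ch. V §3 Prop. 5, Cor. 2–3; Ch. XV §2; [Jacobowitz1962] R. Jacobowitz, Amer. J. Math. 84 (1962): §4.
-/

set_option autoImplicit false

noncomputable section

namespace Summit.HodgeConjecture.HodgeConjecture.Cruxes.H413.F0P3cDyRamRowTowerTopCellPerCellValue


open scoped Valued WithZero Matrix MatrixGroups Classical
open WithZero Finset
open Literature.NumberTheory.Automorphic Literature.NumberTheory.Automorphic.HermitianLattice Literature.NumberTheory.Automorphic.UnitaryLatticeTree
open Literature.NumberTheory.Automorphic.UnitaryThreeFourFrame (IsRamifiedQuadraticDatum normSign)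
open Literature.NumberTheory.LocalFields.WildQuadraticDatum (normSign_eq_of_near)
open Literature.NumberTheory.Rogawski1990
open Summit.HodgeConjecture.HodgeConjecture.Cruxes.H413.F0P3cDyRamFourFramePieces
open Summit.HodgeConjecture.HodgeConjecture.Cruxes.H413.F0P3cDyRamFourFrameCensusDefs (LatticeInLevel LatticeNearTransvShell)
open Summit.HodgeConjecture.HodgeConjecture.Cruxes.H413.F0P3cDyRamStageOneBDefs (mcOfRecord)
open Summit.HodgeConjecture.HodgeConjecture.Cruxes.H413.F0P3cDyRamToricCensusDefs
open Summit.HodgeConjecture.HodgeConjecture.Cruxes.H413.F0P3cDyRamRowCellOnShell (uniformizer_letters)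
open Summit.HodgeConjecture.HodgeConjecture.Cruxes.H413.F0P3cDyRamRowTowerTopVertexLetters (rowTower_topVertex_letters)
open Summit.HodgeConjecture.HodgeConjecture.Cruxes.H413.F0P3cDyRamRowTowerCellPerCellValue (v_coord_sub_coord_le_of_floor)
open Summit.HodgeConjecture.HodgeConjecture.Cruxes.H413.F0P3cDyRamConeCellPerCellLaw (cellDiff_mul_card_eq_cellCount_mul_signSum_of_fibration_reads₃ ite_eq_normSign_mul_normSign)
open Summit.HodgeConjecture.HodgeConjecture.Cruxes.H413.F0P3cDyRamRowCellSocketFibre (fibre_ncard_eq_of_lit_of_gen)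
open Summit.HodgeConjecture.HodgeConjecture.Cruxes.H413.F0P3cDyRamRowCellSocketLit (lit_of_near_of_gen)
open Summit.HodgeConjecture.HodgeConjecture.Cruxes.H413.F0P3cDyRamRowCellSocketReads (exists_coord_of_gen weight_ne_zero_iff_cls_of_gen weight_ne_zero_iff_normSign_pairing_of_gen)
open Summit.HodgeConjecture.HodgeConjecture.Cruxes.H413.F0P3cDyRamRowVertexPopulationRead (normSign_mul_eq_one_iff_eq)
open Summit.HodgeConjecture.HodgeConjecture.Cruxes.H413.F0P3cDyRamRowCellGeneratorIndependence (cls_iff_cls_of_gen normTheta_gen_mul digit_mul_sub_digit)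
open Summit.HodgeConjecture.HodgeConjecture.Cruxes.H413.F0P3cDyRamDiagonalCellGeneratorChange (exists_isOrd_mul_of_presentations)
open Summit.HodgeConjecture.HodgeConjecture.Cruxes.H413.F0P3cDyRamDiagonalCellGeneratorIndependence (v_eq_one_of_isOrd_of_mul_eq_one)
open Summit.HodgeConjecture.HodgeConjecture.Cruxes.H413.F0P3cDyRamRowVertexCoordinateChange (v_normTheta_sub_map_le)
open Summit.HodgeConjecture.HodgeConjecture.Cruxes.H413.F0P3cDyRamRowCellFibreTransport (trace_letters)
open Summit.HodgeConjecture.HodgeConjecture.Cruxes.H413.F0P3cDyRamConeCellGluedVertexExistsOfWeight (exists_glued_of_mem_levelSetDep_of_weight_ne_zero)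
open Summit.HodgeConjecture.HodgeConjecture.Cruxes.H413.F0P3cDyRamConeCellLedgerSizes (levelSetDep_eq_levelSet_of_add_le)

variable {E M : Type} [Field E] [Valued E ℤᵐ⁰] [Field M] [Valued M ℤᵐ⁰]

/-! ## HEAD — ★ K6-0 HEAD′ on the top cell of a row tower, both parities -/
/-- **HEAD — «THE PER-CELL VALUE OF THE TOP CELL OF A ROW TOWER» (F1b-top).**  ★ F1b's binders with `2b + d%2 = m`, the dyadic letter `h2`, `b < j`, the TOP chart
(`j + b + d%2 ≤ jl`, `|ξ₀|·|jEϖ|^{jl} = |jEϖ|^{2b+d%2}`), the label letters `hα₁σ hγ₁σ hγ₁1 hαγ` and the on-shell `haff`, the digit system and the precision letters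
`hrfloor hrR hr₀ hdeep hrtop`.  THEN ★ K6-0 HEAD′'s conclusion with `P₁ Q₁ :=` the two literal sets, `LIT :=` ★ p863983's conjunction, `NX V := |μ_a + μ_b(R₀ + Vγ₀)| = |ϖ|^{2b+d%2}`,
`p := normSign σ (−h_W)`, `ω V := normSign σ (α₁ + γ₁·V)`.
[cite: Kottwitz1986BaseChangeUnits, §1 pp. 240–241] [cite: LabesseLanglands1979, §2 (2.2) p. 9] [cite: Rogawski1990, §4.9 Prop. 4.9.1 (b) p. 55] [cite: Serre1979, Ch. V §3 Cor. 3; Ch. XV §2] -/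
theorem rowTower_topCellDiff_mul_card_eq [CompleteSpace E] [IsDiscreteValuationRing 𝒪[E]] [Finite 𝓀[E]]
    (σ : E →+* E) (ϖ : E) (d tE : ℕ) (hD : IsRamifiedQuadraticDatum σ ϖ d tE)
    (jE : E →+* M) (ρ Θ : M →+* M) (α lam : M)
    (hρρ : ∀ z, ρ (ρ z) = z) (hvρ : ∀ z, Valued.v (ρ z) = Valued.v z)
    (hjv : ∀ a, Valued.v (jE a) ≤ 1 ↔ Valued.v a ≤ 1) (hjfix : ∀ z : M, ρ z = z ↔ ∃ a, jE a = z) (hΘj : ∀ a, Θ (jE a) = jE (σ a))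
    (hΘΘ : ∀ z, Θ (Θ z) = z) (hΘρ : ∀ z, Θ (ρ z) = ρ (Θ z)) (hvΘ : ∀ z, Valued.v (Θ z) = Valued.v z)
    (hα : ρ α ≠ α) (hα1 : Valued.v α ≤ 1) (hint : ∀ z : M, Valued.v z ≤ 1 → Valued.v ((z - ρ z) / (α - ρ α)) ≤ 1)
    (hvlam : Valued.v lam = 1) (hU : Valued.v (α - ρ α) = 1) (hjiso : ∀ a, Valued.v (jE a) = Valued.v a)
    (hjpow : ∀ (t : E) (n : ℤ), Valued.v (jE t) = Valued.v (jE ϖ) ^ n ↔ Valued.v t = Valued.v ϖ ^ n)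
    (hϖmax : ∀ t : M, ρ t = t → Valued.v t < 1 → Valued.v t ≤ Valued.v (jE ϖ))
    (γ₂ : GL (Fin 2) E) (u : GL (Fin 1) E) (m jl : ℕ) (hm : Valued.v (lam - jE ((u : Matrix (Fin 1) (Fin 1) E) 0 0)) = WithZero.exp (-(m : ℤ)))
    (hjl : Valued.v ((lam - jE ((u : Matrix (Fin 1) (Fin 1) E) 0 0)) - ρ (lam - jE ((u : Matrix (Fin 1) (Fin 1) E) 0 0))) = WithZero.exp (-(jl : ℤ)))
    (hum : Valued.v (((u : Matrix (Fin 1) (Fin 1) E) 0 0) - 1) ≤ Valued.v (ϖ ^ mstarOfRecord d))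
    (H₂ : Matrix (Fin 2) (Fin 2) E) (hW : E) (hH₂ : IsUnit H₂.det) (hH₂σ : (H₂.map σ)ᵀ = H₂) (hhW : Valued.v hW = 1) (hhWσ : σ hW = hW)
    (φ : (Fin 2 → E) →+ M) (h : M) (hφs : ∀ (c : E) (x : Fin 2 → E), φ (c • x) = jE c * φ x) (hφi : Function.Injective φ) (hφo : Function.Surjective φ)
    (hφγ : ∀ x, φ ((γ₂ : Matrix (Fin 2) (Fin 2) E).mulVec x) = lam * φ x)
    (hform : ∀ x y, jE (pairing σ H₂ x y) = h * Θ (φ x) * φ y + ρ (h * Θ (φ x) * φ y)) (hΘh : Θ h = h) (hh : h ≠ 0)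
    (f : ℕ → ℕ → AddSubgroup M → ℕ)
    (hf : ∀ (b j : ℕ) (Λ : AddSubgroup M) (x₀ : M) (r : E), 1 ≤ b → x₀ ≠ 0 → (∀ x, x ∈ Λ ↔ ∃ z, IsOrd ρ α (jE ϖ ^ j) z ∧ x = x₀ * z) →
      IsOrd ρ α (jE ϖ ^ j) (dualGen ρ Θ α (jE ϖ ^ j) h x₀) → ¬ IsOrd ρ α (jE ϖ ^ j) (dualGen ρ Θ α (jE ϖ ^ j) h x₀ / jE ϖ) → Valued.v (dualGen ρ Θ α (jE ϖ ^ j) h x₀) = Valued.v (jE ϖ) ^ b →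
      (∀ b', (∀ x ∈ Λ, Valued.v (h * Θ x * b' + ρ (h * Θ x * b')) ≤ 1) → (lam - jE ((u : Matrix (Fin 1) (Fin 1) E) 0 0)) * b' ∈ Λ) → IsOrd ρ α (jE ϖ ^ j) lam →
      jE r = glueUnit ρ Θ α (jE ϖ ^ j) h (jE ϖ) (jE hW) x₀ b →
      f b j Λ = Nat.card {x : 𝒪[E] ⧸ 𝓂[E] ^ (2 * b) // ∃ u' : 𝒪[E], Ideal.Quotient.mk (𝓂[E] ^ (2 * b)) u' = x ∧ Valued.v ((u' : E) * σ u' - r) ≤ Valued.v (ϖ ^ (2 * b))})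
    (hfinLS : ∀ j a, (levelSet ρ Θ α (jE ϖ) h j a).Finite)
    (b : ℕ) (hbm : 2 * b + d % 2 = m)
    (hΘlam : Θ lam * lam = 1) (P₁ : GL (Fin 3) E)
    (hA : formCongr σ P₁ ((StdForm.antidiagonal 3).over E) = (!![H₂ 0 0, 0, H₂ 0 1; 0, hW, 0; H₂ 1 0, 0, H₂ 1 1] : Matrix (Fin 3) (Fin 3) E))
    (hΓ : P₁ * endoGL (γ₂, u) * P₁⁻¹ ∈ unitaryGroupOfForm σ ((StdForm.antidiagonal 3).over E))
    (hmcm : mcOfRecord d ≤ m) (hlamn : Valued.v (lam - 1) ≤ Valued.v (jE ϖ) ^ mcOfRecord d)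
    (hun : Valued.v ((u : Matrix (Fin 1) (Fin 1) E) 0 0 - 1) ≤ Valued.v ϖ ^ mcOfRecord d)
    (hFgap : ∀ z : M, ρ z = z → Θ z = z → Valued.v (jE ϖ) < Valued.v z → Valued.v z ≤ 1 → Valued.v z = 1)
    -- the dyadic letter (‹CORE›'s `_h2` BY NAME) and the class letters of the frame
    (h2 : ¬ IsUnit (2 : 𝒪[E]))
    (hdeep₂ : ∀ w : M, ρ w = w → Θ w = w → Valued.v (w - 1) ≤ Valued.v (jE ϖ) ^ (2 * d) → ∃ c : M, ρ c = c ∧ c * Θ c = w)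
    {c₀ : M} (hc₀1 : Valued.v c₀ = 1)
    (hdich : ∀ x : M, Θ x = x → Valued.v x = 1 → (∃ z : M, z * Θ z = x) ∨ ∃ z : M, z * Θ z = c₀ * x)
    (hwit : ∃ a : M, Θ a = a ∧ Valued.v a = 1 ∧ ¬ ∃ e : M, ρ e = e ∧ e * Θ e = a * ρ a)
    -- the cell
    {j : ℕ} (hbj : b < j) (hjm : j + mstarOfRecord d ≤ jl)
    -- the TOP chart (`|ξ₀| = exp(jl − m)`, `g = 0`)
    {κ₀ ξ₀ : M} (hκ₀ : κ₀ + ρ κ₀ = 1) (hΘκ₀ : Θ κ₀ = κ₀) (hκ₀1 : Valued.v κ₀ ≤ 1) (hξ : ρ ξ₀ = -ξ₀) (hΘξ : Θ ξ₀ = ξ₀)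
    (hcell : j + b + d % 2 ≤ jl) (hξv : Valued.v ξ₀ * Valued.v (jE ϖ) ^ jl = Valued.v (jE ϖ) ^ (2 * b + d % 2))
    {μa μb R₀ γ₀ : E} (hμab : lam - jE ((u : Matrix (Fin 1) (Fin 1) E) 0 0) = jE μa + jE μb * α)
    (hR₀ : jE R₀ = α * κ₀ + ρ (α * κ₀)) (hγ₀ : jE γ₀ = ξ₀ * (α - ρ α))
    {α₁ γ₁ : E} (hα₁σ : σ α₁ = α₁) (hγ₁σ : σ γ₁ = γ₁) (hγ₁1 : Valued.v γ₁ ≤ 1)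
    (hαγ : ∀ V : E, σ V = V → Valued.v V ≤ 1 → Valued.v (μa + μb * (R₀ + V * γ₀)) = Valued.v ϖ ^ (2 * b + d % 2) → Valued.v (α₁ + γ₁ * V) = 1)
    (haff : ∀ (T W f : E), σ T = T → Valued.v T = 1 → σ W = W → Valued.v W ≤ 1 → σ f = f →
      Valued.v ((μa + μb * R₀) * ((ϖ * σ ϖ) ^ b)⁻¹ + μb * γ₀ * ((ϖ * σ ϖ) ^ b)⁻¹ * W) = Valued.v ((μa + μb * R₀) * ((ϖ * σ ϖ) ^ b)⁻¹) →
      Valued.v (T * ((μa + μb * R₀) * ((ϖ * σ ϖ) ^ b)⁻¹ + μb * γ₀ * ((ϖ * σ ϖ) ^ b)⁻¹ * W) - f * ((ϖ - σ ϖ) * ((ϖ * σ ϖ) ^ ((d - d % 2) / 2))⁻¹)) ≤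
        Valued.v ϖ ^ mstarOfRecord d → normSign σ f = normSign σ T * normSign σ (α₁ + γ₁ * W))
    -- the digit system and the precision letters
    (Rd : Finset E) (hRdσ : ∀ V ∈ Rd, σ V = V) {r r₀ : ℤᵐ⁰}
    (hRd2 : ∀ V : E, σ V = V → Valued.v V ≤ 1 → ∃ V₀ ∈ Rd, Valued.v (V - V₀) ≤ r)
    (hRd3 : ∀ V ∈ Rd, ∀ V' ∈ Rd, Valued.v (V - V') ≤ r → V = V')
    (hrfloor : Valued.v (jE ϖ) ^ (2 * b) ≤ r * Valued.v ξ₀ * Valued.v (jE ϖ ^ j * (α - ρ α)))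
    (hrR : r * Valued.v ξ₀ * Valued.v (jE ϖ ^ j * (α - ρ α)) < Valued.v (jE ϖ) ^ b)
    (hr₀ : r * Valued.v ξ₀ * Valued.v (jE ϖ ^ j * (α - ρ α)) ≤ r₀ * Valued.v (jE ϖ) ^ b)
    (hdeep : ∀ w : M, ρ w = w → Θ w = w → Valued.v (w - 1) ≤ r₀ → ∃ c : M, ρ c = c ∧ c * Θ c = w)
    (hrtop : r ≤ Valued.v ϖ ^ (2 * d - 1)) :
    (((∑ᶠ Λ ∈ levelSetDep ρ Θ α (jE ϖ) h j b (lam - jE ((u : Matrix (Fin 1) (Fin 1) E) 0 0)) ∩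
                      {Λ | ∃ B : Submodule 𝒪[E] (Fin 2 → E), B.toAddSubgroup.map φ = Λ ∧
                        ∃ L₃ : Submodule 𝒪[E] (Fin 3 → E), IsSelfDualLattice σ ϖ (!![H₂ 0 0, 0, H₂ 0 1; 0, hW, 0; H₂ 1 0, 0, H₂ 1 1] : Matrix (Fin 3) (Fin 3) E) L₃ ∧
                          L₃ ⊓ LinearMap.ker ((LinearMap.proj (1 : Fin 3) : (Fin 3 → E) →ₗ[E] E).restrictScalars 𝒪[E]) =
                            B.map ((Matrix.toLin' (!![1, 0; 0, 0; 0, 1] : Matrix (Fin 3) (Fin 2) E)).restrictScalars 𝒪[E]) ∧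
                          (∀ c : E, (Pi.single 1 c : Fin 3 → E) ∈ L₃ ↔ Valued.v c ≤ Valued.v ϖ ^ b) ∧
                          (LatticeNearTransvShell ϖ (d % 2) (mstarOfRecord d) ((((endoGL (γ₂, u) : GL (Fin 3) E) : Matrix (Fin 3) (Fin 3) E) - 1)) L₃ ∧
                            {z : E | ∃ y ∈ L₃, Valued.v ((ϖ ^ (mstarOfRecord d))⁻¹ * (z - pairing σ (!![H₂ 0 0, 0, H₂ 0 1; 0, hW, 0; H₂ 1 0, 0, H₂ 1 1] : Matrix (Fin 3) (Fin 3) E) y (((((endoGL (γ₂, u) : GL (Fin 3) E) : Matrix (Fin 3) (Fin 3) E) - 1)) *ᵥ y))) ≤ 1} =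
                              valueSetMod σ ϖ (mstarOfRecord d) (xPlus σ ϖ d))}, f b j Λ : ℕ) : ℤ) -
                  ((∑ᶠ Λ ∈ levelSetDep ρ Θ α (jE ϖ) h j b (lam - jE ((u : Matrix (Fin 1) (Fin 1) E) 0 0)) ∩
                      {Λ | ∃ B : Submodule 𝒪[E] (Fin 2 → E), B.toAddSubgroup.map φ = Λ ∧
                        ∃ L₃ : Submodule 𝒪[E] (Fin 3 → E), IsSelfDualLattice σ ϖ (!![H₂ 0 0, 0, H₂ 0 1; 0, hW, 0; H₂ 1 0, 0, H₂ 1 1] : Matrix (Fin 3) (Fin 3) E) L₃ ∧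
                          L₃ ⊓ LinearMap.ker ((LinearMap.proj (1 : Fin 3) : (Fin 3 → E) →ₗ[E] E).restrictScalars 𝒪[E]) =
                            B.map ((Matrix.toLin' (!![1, 0; 0, 0; 0, 1] : Matrix (Fin 3) (Fin 2) E)).restrictScalars 𝒪[E]) ∧
                          (∀ c : E, (Pi.single 1 c : Fin 3 → E) ∈ L₃ ↔ Valued.v c ≤ Valued.v ϖ ^ b) ∧
                          (LatticeNearTransvShell ϖ (d % 2) (mcOfRecord d) ((((endoGL (γ₂, u) : GL (Fin 3) E) : Matrix (Fin 3) (Fin 3) E) - 1)) L₃ ∧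
                            ¬ {z : E | ∃ y ∈ L₃, Valued.v ((ϖ ^ (mstarOfRecord d))⁻¹ * (z - pairing σ (!![H₂ 0 0, 0, H₂ 0 1; 0, hW, 0; H₂ 1 0, 0, H₂ 1 1] : Matrix (Fin 3) (Fin 3) E) y (((((endoGL (γ₂, u) : GL (Fin 3) E) : Matrix (Fin 3) (Fin 3) E) - 1)) *ᵥ y))) ≤ 1} =
                              valueSetMod σ ϖ (mstarOfRecord d) (xPlus σ ϖ d))}, f b j Λ : ℕ) : ℤ)) *
        ((Rd.filter (fun V₀ : E => Valued.v (κ₀ + jE V₀ * ξ₀) * Valued.v (jE ϖ ^ j * (α - ρ α)) = Valued.v (jE ϖ) ^ b ∧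
        ∃ e : M, ρ e = e ∧ e * Θ e = (κ₀ + jE V₀ * ξ₀) * ρ (κ₀ + jE V₀ * ξ₀) / (h * ρ h))).card : ℤ) =
      ((∑ᶠ Λ ∈ levelSetDep ρ Θ α (jE ϖ) h j b (lam - jE ((u : Matrix (Fin 1) (Fin 1) E) 0 0)), f b j Λ : ℕ) : ℤ) *
        (normSign σ (-hW) * ∑ V ∈ (Rd.filter (fun V₀ : E => Valued.v (κ₀ + jE V₀ * ξ₀) * Valued.v (jE ϖ ^ j * (α - ρ α)) = Valued.v (jE ϖ) ^ b ∧
        ∃ e : M, ρ e = e ∧ e * Θ e = (κ₀ + jE V₀ * ξ₀) * ρ (κ₀ + jE V₀ * ξ₀) / (h * ρ h))).filter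
          (fun V => Valued.v (μa + μb * (R₀ + V * γ₀)) = Valued.v ϖ ^ (2 * b + d % 2)), normSign σ (α₁ + γ₁ * V)) := by
  classical
  obtain ⟨hσσ, hvσ, hϖ, -, -, hdpos, -⟩ := id hD
  obtain ⟨hϖ0, hϖlt, hjϖ0, hvjϖ0, hvjϖpos, hjϖlt, hjϖle⟩ := uniformizer_letters jE hjv hϖ
  have hπ : Valued.v (jE ϖ) = exp (-1 : ℤ) := by rw [hjiso, hϖ]
  have hπn : ∀ n : ℕ, Valued.v (jE ϖ) ^ n = exp (-(n : ℤ)) := fun n => by rw [hπ, ← exp_nsmul, nsmul_eq_mul, mul_neg, mul_one]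
  have hρj : ∀ c : E, ρ (jE c) = jE c := fun c => (hjfix _).2 ⟨c, rfl⟩
  have hm1 : mstarOfRecord d = d % 2 + 2 * d - 1 := rfl
  have hmc : mcOfRecord d = 2 * ((d % 2 + 2 * d - 1 + d) / 2) := rfl
  have hb1 : 1 ≤ b := by omega
  have hdb : d ≤ b := by omega
  have h2v : Valued.v (2 : E) < 1 := by exact_mod_cast Valuation.Integer.not_isUnit_iff_valuation_lt_one.mp h2
  have hhW1 : Valued.v (jE hW) = 1 := by rw [hjiso, hhW]
  have hccv : Valued.v (jE ϖ ^ j * (α - ρ α)) = Valued.v (jE ϖ) ^ j := by rw [Valuation.map_mul, hU, mul_one, Valuation.map_pow]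
  have hccA : jE ϖ ^ j * (α - ρ α) ≠ 0 := mul_ne_zero (pow_ne_zero _ hjϖ0) (sub_ne_zero.2 (Ne.symm hα))
  have hμρ : Valued.v ((lam - jE ((u : Matrix (Fin 1) (Fin 1) E) 0 0)) - ρ (lam - jE ((u : Matrix (Fin 1) (Fin 1) E) 0 0))) = Valued.v (jE ϖ) ^ jl := by
    rw [hjl, hπn]
  have hlamj : IsOrd ρ α (jE ϖ ^ j) lam := by
    refine ⟨hvlam.le, ?_⟩
    have hlamρ : lam - ρ lam = (lam - jE ((u : Matrix (Fin 1) (Fin 1) E) 0 0)) - ρ (lam - jE ((u : Matrix (Fin 1) (Fin 1) E) 0 0)) := by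
      rw [map_sub, hρj]; ring
    rw [hlamρ, hμρ, hccv]; exact pow_le_pow_right_of_le_one' hjϖle (by omega)
  have hξ0 : ξ₀ ≠ 0 := fun h0 => by
    rw [h0, Valuation.map_zero, zero_mul] at hξv; exact pow_ne_zero _ hvjϖ0 hξv.symm
  have hξR : Valued.v (jE ϖ) ^ b ≤ Valued.v ξ₀ * Valued.v (jE ϖ ^ j * (α - ρ α)) := by
    rw [hccv]
    have h1 : Valued.v ξ₀ * Valued.v (jE ϖ) ^ j * Valued.v (jE ϖ) ^ jl = Valued.v (jE ϖ) ^ (2 * b + d % 2 + j) := by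
      rw [mul_assoc, mul_comm (Valued.v (jE ϖ) ^ j), ← mul_assoc, hξv, ← pow_add]
    have h2 : Valued.v (jE ϖ) ^ b * Valued.v (jE ϖ) ^ jl ≤ Valued.v (jE ϖ) ^ (2 * b + d % 2 + j) := by
      rw [← pow_add]; exact pow_le_pow_right_of_le_one' hjϖle (by omega)
    rw [← h1] at h2
    exact le_of_mul_le_mul_right h2 (pow_pos hvjϖpos _)
  have hξ1 : 1 ≤ Valued.v ξ₀ := by
    have h1 : 1 * Valued.v (jE ϖ) ^ jl ≤ Valued.v ξ₀ * Valued.v (jE ϖ) ^ jl := by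
      rw [one_mul, hξv]; exact pow_le_pow_right_of_le_one' hjϖle (by omega)
    exact le_of_mul_le_mul_right h1 (pow_pos hvjϖpos _)
  -- the row's `hcell` (★ `levelSetDep_eq_levelSet_of_add_le`: `2b ≤ m`, `j + b ≤ jl`)
  have hcellEq : levelSetDep ρ Θ α (jE ϖ) h j b (lam - jE ((u : Matrix (Fin 1) (Fin 1) E) 0 0)) = levelSet ρ Θ α (jE ϖ) h j b :=
    levelSetDep_eq_levelSet_of_add_le hρρ hvρ hΘΘ hΘρ hvΘ hα1 hU (hρj ϖ) hπ hh hm hjl hb1 (by omega) (by omega)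
  -- (hV) ★ p863914 and the label constancy §2, as functions
  have hV : ∀ (Λ : AddSubgroup M) (x₀ : M), (x₀ ≠ 0 ∧ (∀ x, x ∈ Λ ↔ ∃ ζ, IsOrd ρ α (jE ϖ ^ j) ζ ∧ x = x₀ * ζ) ∧
          IsOrd ρ α (jE ϖ ^ j) (dualGen ρ Θ α (jE ϖ ^ j) h x₀) ∧ ¬ IsOrd ρ α (jE ϖ ^ j) (dualGen ρ Θ α (jE ϖ ^ j) h x₀ / jE ϖ) ∧
          Valued.v (dualGen ρ Θ α (jE ϖ ^ j) h x₀) = Valued.v (jE ϖ) ^ b) →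
      ∃ Ve : E, jE Ve = (ρ (h * (x₀ * Θ x₀)) / (h * (x₀ * Θ x₀) + ρ (h * (x₀ * Θ x₀))) - κ₀) / ξ₀ ∧ σ Ve = Ve ∧ Valued.v Ve ≤ 1 := fun Λ x₀ hG =>
    exists_coord_of_gen hD jE hjv hjfix hΘj hρρ hvρ hΘΘ hΘρ hΘh hb1 hccA hFgap hκ₀ hΘκ₀ hξ hΘξ hξ0 (hκ₀1.trans hξ1) hξR Λ x₀ hG
  -- the digit term of the TOP chart has the size of the main term: `|μ_bγ₀| = |ϖ|^{2b+d%2}`; NX is constant on balls of radius `r ≤ |ϖ|^{2d−1} < 1`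
  have hμρ' : (lam - jE ((u : Matrix (Fin 1) (Fin 1) E) 0 0)) - ρ (lam - jE ((u : Matrix (Fin 1) (Fin 1) E) 0 0)) = jE μb * (α - ρ α) := by
    rw [hμab, map_add, map_mul, hρj, hρj]; ring
  have hμbv : Valued.v (jE μb) = Valued.v (jE ϖ) ^ jl := by
    have e : jE μb = ((lam - jE ((u : Matrix (Fin 1) (Fin 1) E) 0 0)) - ρ (lam - jE ((u : Matrix (Fin 1) (Fin 1) E) 0 0))) / (α - ρ α) := by
      rw [hμρ', mul_div_cancel_right₀ _ (sub_ne_zero.2 (Ne.symm hα))]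
    rw [e, map_div₀, hμρ, hU, div_one]
  have hbh : Valued.v (μb * γ₀) = Valued.v ϖ ^ (2 * b + d % 2) := by
    rw [← hjiso, map_mul, Valuation.map_mul, hμbv, hγ₀, Valuation.map_mul, hU, mul_one, mul_comm, hξv, hjiso]
  have hNXc : ∀ Ve V' : E, Valued.v (Ve - V') ≤ r →
      (Valued.v (μa + μb * (R₀ + Ve * γ₀)) = Valued.v ϖ ^ (2 * b + d % 2) ↔ Valued.v (μa + μb * (R₀ + V' * γ₀)) = Valued.v ϖ ^ (2 * b + d % 2)) := by
    have key : ∀ Ve V' : E, Valued.v (Ve - V') ≤ r → Valued.v (μa + μb * (R₀ + V' * γ₀)) = Valued.v ϖ ^ (2 * b + d % 2) →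
        Valued.v (μa + μb * (R₀ + Ve * γ₀)) = Valued.v ϖ ^ (2 * b + d % 2) := by
      intro Ve V' hVV' hV'
      have e : μa + μb * (R₀ + Ve * γ₀) = (μa + μb * (R₀ + V' * γ₀)) + μb * γ₀ * (Ve - V') := by ring
      have hlt : Valued.v (μb * γ₀ * (Ve - V')) < Valued.v (μa + μb * (R₀ + V' * γ₀)) := by
        rw [hV', Valuation.map_mul, hbh]
        calc Valued.v ϖ ^ (2 * b + d % 2) * Valued.v (Ve - V') ≤ Valued.v ϖ ^ (2 * b + d % 2) * Valued.v ϖ ^ (2 * d - 1) :=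
              mul_le_mul' le_rfl (hVV'.trans hrtop)
          _ < Valued.v ϖ ^ (2 * b + d % 2) := by rw [← pow_add]; exact pow_lt_pow_right_of_lt_one₀ (zero_lt_iff.2 ((Valuation.ne_zero_iff _).2 hϖ0)) hϖlt (by omega)
      rw [e, Valuation.map_add_eq_of_lt_left _ hlt, hV']
    intro Ve V' hVV'
    refine ⟨fun h => key V' Ve (by rw [← Valuation.map_neg, neg_sub]; exact hVV') h, key Ve V' hVV'⟩
  -- ON the shell the label is constant on balls of radius `r` (the unit letter `hαγ` + ★ Lit `normSign_eq_of_near`; `|γ₁| ≤ 1`, `r ≤ |ϖ|^{2d−1}`)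
  have hψc : ∀ Ve V' : E, σ Ve = Ve → Valued.v Ve ≤ 1 → σ V' = V' → Valued.v (Ve - V') ≤ r →
      Valued.v (μa + μb * (R₀ + Ve * γ₀)) = Valued.v ϖ ^ (2 * b + d % 2) → normSign σ (α₁ + γ₁ * V') = normSign σ (α₁ + γ₁ * Ve) := by
    intro Ve V' hσVe hVe1 hσV' hnear hNX
    have hg1 : Valued.v (α₁ + γ₁ * Ve) = 1 := hαγ Ve hσVe hVe1 hNX
    have hσg : σ (α₁ + γ₁ * Ve) = α₁ + γ₁ * Ve := by rw [map_add, map_mul, hα₁σ, hγ₁σ, hσVe]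
    have hσg' : σ (α₁ + γ₁ * V') = α₁ + γ₁ * V' := by rw [map_add, map_mul, hα₁σ, hγ₁σ, hσV']
    have hnear' : Valued.v ((α₁ + γ₁ * Ve) - (α₁ + γ₁ * V')) ≤ Valued.v ϖ ^ (2 * d - 1) := by
      rw [show (α₁ + γ₁ * Ve) - (α₁ + γ₁ * V') = γ₁ * (Ve - V') by ring, Valuation.map_mul]
      exact (mul_le_mul' hγ₁1 (hnear.trans hrtop)).trans (by rw [one_mul])
    exact normSign_eq_of_near hD hσg hσg' hg1 le_rfl hnear'
  -- THE JUNCTION: a glued vertex over a weighted member reads both shells and `VS = X₊ ↔ ψ Ve` at ANY generator's coordinate `Ve`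
  have hjunc : ∀ {Λ : AddSubgroup M}, Λ ∈ levelSetDep ρ Θ α (jE ϖ) h j b (lam - jE ((u : Matrix (Fin 1) (Fin 1) E) 0 0)) →
      ∀ {B : Submodule 𝒪[E] (Fin 2 → E)}, B.toAddSubgroup.map φ = Λ → ∀ {L₃ : Submodule 𝒪[E] (Fin 3 → E)},
      IsSelfDualLattice σ ϖ (!![H₂ 0 0, 0, H₂ 0 1; 0, hW, 0; H₂ 1 0, 0, H₂ 1 1] : Matrix (Fin 3) (Fin 3) E) L₃ →
      L₃ ⊓ LinearMap.ker ((LinearMap.proj (1 : Fin 3) : (Fin 3 → E) →ₗ[E] E).restrictScalars 𝒪[E]) =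
        B.map ((Matrix.toLin' (!![1, 0; 0, 0; 0, 1] : Matrix (Fin 3) (Fin 2) E)).restrictScalars 𝒪[E]) →
      (∀ c : E, (Pi.single 1 c : Fin 3 → E) ∈ L₃ ↔ Valued.v c ≤ Valued.v ϖ ^ b) → f b j Λ ≠ 0 →
      ∀ {x₀ : M}, (x₀ ≠ 0 ∧ (∀ x, x ∈ Λ ↔ ∃ ζ, IsOrd ρ α (jE ϖ ^ j) ζ ∧ x = x₀ * ζ) ∧
          IsOrd ρ α (jE ϖ ^ j) (dualGen ρ Θ α (jE ϖ ^ j) h x₀) ∧ ¬ IsOrd ρ α (jE ϖ ^ j) (dualGen ρ Θ α (jE ϖ ^ j) h x₀ / jE ϖ) ∧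
          Valued.v (dualGen ρ Θ α (jE ϖ ^ j) h x₀) = Valued.v (jE ϖ) ^ b) → ∀ {Ve : E}, jE Ve = (ρ (h * (x₀ * Θ x₀)) / (h * (x₀ * Θ x₀) + ρ (h * (x₀ * Θ x₀))) - κ₀) / ξ₀ → σ Ve = Ve → Valued.v Ve ≤ 1 →
      (LatticeNearTransvShell ϖ (d % 2) (mstarOfRecord d) ((((endoGL (γ₂, u) : GL (Fin 3) E) : Matrix (Fin 3) (Fin 3) E) - 1)) L₃ ↔
          Valued.v (μa + μb * (R₀ + Ve * γ₀)) = Valued.v ϖ ^ (2 * b + d % 2)) ∧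
      (LatticeNearTransvShell ϖ (d % 2) (mcOfRecord d) ((((endoGL (γ₂, u) : GL (Fin 3) E) : Matrix (Fin 3) (Fin 3) E) - 1)) L₃ ↔
          Valued.v (μa + μb * (R₀ + Ve * γ₀)) = Valued.v ϖ ^ (2 * b + d % 2)) ∧
        (Valued.v (μa + μb * (R₀ + Ve * γ₀)) = Valued.v ϖ ^ (2 * b + d % 2) →
        (({z : E | ∃ y ∈ L₃, Valued.v ((ϖ ^ (mstarOfRecord d))⁻¹ * (z - pairing σ (!![H₂ 0 0, 0, H₂ 0 1; 0, hW, 0; H₂ 1 0, 0, H₂ 1 1] : Matrix (Fin 3) (Fin 3) E) y (((((endoGL (γ₂, u) : GL (Fin 3) E) : Matrix (Fin 3) (Fin 3) E) - 1)) *ᵥ y))) ≤ 1} =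
            valueSetMod σ ϖ (mstarOfRecord d) (xPlus σ ϖ d)) ↔ normSign σ (α₁ + γ₁ * Ve) = normSign σ (-hW))) := by
    intro Λ hΛ B hBΛ L₃ hL hLB htube hfne x₀ hG Ve hjVe hσVe hVe1
    obtain ⟨x₁, w₀, V₁, hx₁, hΛx, hyO, hyp, hylev, -, hTr, -, -, hσV₁, hV₁1, -, hκ₁, hS, hL'⟩ :=
      rowTower_topVertex_letters σ ϖ d tE hD jE ρ Θ α lam hρρ hvρ hjv hjfix hΘj hΘΘ hΘρ hvΘ hα hα1 hint hvlam hU hjiso hjpow hϖmax γ₂ u m jl hm hjl hum H₂ hW hH₂ hH₂σ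
        hhW hhWσ φ h hφs hφi hφo hφγ hform hΘh hh b hbm hΘlam P₁ hA hΓ hmcm hlamn hun hFgap hbj hjm hκ₀ hΘκ₀ hκ₀1 hξ hΘξ hcell hξv hμab hR₀ hγ₀ haff hΛ hBΛ hL hLB
        htube
    have hG₁ : (x₁ ≠ 0 ∧ (∀ x, x ∈ Λ ↔ ∃ ζ, IsOrd ρ α (jE ϖ ^ j) ζ ∧ x = x₁ * ζ) ∧
          IsOrd ρ α (jE ϖ ^ j) (dualGen ρ Θ α (jE ϖ ^ j) h x₁) ∧ ¬ IsOrd ρ α (jE ϖ ^ j) (dualGen ρ Θ α (jE ϖ ^ j) h x₁ / jE ϖ) ∧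
          Valued.v (dualGen ρ Θ α (jE ϖ ^ j) h x₁) = Valued.v (jE ϖ) ^ b) := ⟨hx₁, hΛx, hyO, hyp, hylev⟩
    -- the population constant (★ p863914 §3) turns ★ M1's label into `ψ V₁`
    have hpop := (weight_ne_zero_iff_normSign_pairing_of_gen hD h2v jE hjv hjfix hΘj hρρ hvρ hΘΘ hΘρ hvΘ hΘh hh hb1 hdb hccA hFgap hhWσ hhW1 hlamj f hf hcellEq
      Λ x₁ hG₁ hTr).1 hfne
    -- the NX predicate and the label pass from the presentation's `V₁ = Vf x₁` to `Ve = Vf x₀` (★ F1b §1: `|Ve − V₁| ≤ r`)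
    have hVf₁ : (ρ (h * (x₁ * Θ x₁)) / (h * (x₁ * Θ x₁) + ρ (h * (x₁ * Θ x₁))) - κ₀) / ξ₀ = jE V₁ := by
      rw [hκ₁, add_sub_cancel_left, mul_div_cancel_right₀ _ hξ0]
    have hnear : Valued.v (Ve - V₁) ≤ r := by
      have h1 := v_coord_sub_coord_le_of_floor jE hjfix hjϖ0 hjϖle hρρ hvρ hΘΘ hΘρ hvΘ hΘh hb1 hccA hFgap κ₀ hξ0 hrfloor Λ x₁ x₀ hG₁ hG
      rw [← hjVe, hVf₁, ← map_sub, hjiso] at h1; exact h1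
    have hNXt := hNXc Ve V₁ hnear
    refine ⟨(hS _ (by omega) (by omega)).trans hNXt.symm, (hS _ (by omega) (by omega)).trans hNXt.symm, fun hNXe => ?_⟩
    have hWV : Valued.v (μb * γ₀) * Valued.v (Ve - V₁) ≤ Valued.v ϖ ^ (2 * b + mstarOfRecord d) := by
      rw [hbh]
      calc Valued.v ϖ ^ (2 * b + d % 2) * Valued.v (Ve - V₁) ≤ Valued.v ϖ ^ (2 * b + d % 2) * Valued.v ϖ ^ (2 * d - 1) := mul_le_mul' le_rfl (hnear.trans hrtop)
        _ = Valued.v ϖ ^ (2 * b + mstarOfRecord d) := by rw [← pow_add, hm1]; congr 1; omega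
    exact (hL' (hNXt.1 hNXe) Ve hσVe hVe1 hNXe hWV).trans (normSign_mul_eq_one_iff_eq hpop (α₁ + γ₁ * Ve))
  -- ★ K6-0 HEAD′ with the reads by name
  refine cellDiff_mul_card_eq_cellCount_mul_signSum_of_fibration_reads₃ σ hσσ hvσ hϖ hD h2v hH₂σ hhW hhWσ jE hρρ hvρ hα hα1 hint hΘΘ hΘρ hvΘ hΘj hjv hjfix hjpow
    hϖmax φ hφs hφi hφo hφγ hvlam hΘh hh hform ((u : Matrix (Fin 1) (Fin 1) E) 0 0) hb1 hdb hlamj f hf hjiso hcellEq (hfinLS j b)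
    (fun x₀ => ∃ e : M, ρ e = e ∧ e * Θ e = h * (x₀ * Θ x₀) + ρ (h * (x₀ * Θ x₀)))
    (fun x₀ => (ρ (h * (x₀ * Θ x₀)) / (h * (x₀ * Θ x₀) + ρ (h * (x₀ * Θ x₀))) - κ₀) / ξ₀)
    (∃ e : M, ρ e = e ∧ e * Θ e = -(h * ρ h * ((α - ρ α) * Θ (α - ρ α)) * jE hW)) r Rd hRd2 hRd3
    (fun V₀ : E => Valued.v (κ₀ + jE V₀ * ξ₀) * Valued.v (jE ϖ ^ j * (α - ρ α)) = Valued.v (jE ϖ) ^ b ∧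
      ∃ e : M, ρ e = e ∧ e * Θ e = (κ₀ + jE V₀ * ξ₀) * ρ (κ₀ + jE V₀ * ξ₀) / (h * ρ h))
    (fun V => Valued.v (μa + μb * (R₀ + V * γ₀)) = Valued.v ϖ ^ (2 * b + d % 2))
    (fun V => Valued.v (μa + μb * (R₀ + V * γ₀)) = Valued.v ϖ ^ (2 * b + d % 2) → normSign σ (α₁ + γ₁ * V) = normSign σ (-hW))
    (fun Λ x₀ x₀' hG hG' => ⟨cls_iff_cls_of_gen hD jE hjv hjfix hΘj hρρ hvρ hΘΘ hΘρ hvΘ hα hα1 hint hΘh hb1 hdb hbj.le hccA hFgap hdeep₂ Λ x₀ x₀' hG hG',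
      v_coord_sub_coord_le_of_floor jE hjfix hjϖ0 hjϖle hρρ hvρ hΘΘ hΘρ hvΘ hΘh hb1 hccA hFgap κ₀ hξ0 hrfloor Λ x₀ x₀' hG hG'⟩)
    hV
    (fun Λ x₀ V₀ hG hV₀ hnear => lit_of_near_of_gen hD jE hjv hjfix hΘj hρρ hvρ hΘΘ hΘρ hΘh hh hb1 hccA hFgap hκ₀ hΘκ₀ hξ hΘξ hξ0 hrR hr₀ hdeep Λ x₀ hG V₀
      (hRdσ V₀ hV₀) hnear)
    (fun Ve V₀ _ _ _ hnear => hNXc Ve V₀ hnear)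
    (fun Ve V₀ hσVe hVe1 hV₀ hnear =>
      ⟨fun hΨ hN₀ => (hψc Ve V₀ hσVe hVe1 (hRdσ V₀ hV₀) hnear ((hNXc Ve V₀ hnear).2 hN₀)).trans (hΨ ((hNXc Ve V₀ hnear).2 hN₀)),
        fun hΨ hNe => (hψc Ve V₀ hσVe hVe1 (hRdσ V₀ hV₀) hnear hNe).symm.trans (hΨ ((hNXc Ve V₀ hnear).1 hNe))⟩)
    (fibre_ncard_eq_of_lit_of_gen hD jE hjiso hjfix hΘj hρρ hvρ hΘΘ hΘρ hΘh hh hb1 hccA hFgap (hfinLS j b) hc₀1 hdich hwit hκ₀ hΘκ₀ hξ hΘξ hξ0 hrR hr₀ hdeep _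
      Rd hRdσ _ (fun V _ hL => hL))
    (fun Λ => ∃ B : Submodule 𝒪[E] (Fin 2 → E), B.toAddSubgroup.map φ = Λ ∧
                        ∃ L₃ : Submodule 𝒪[E] (Fin 3 → E), IsSelfDualLattice σ ϖ (!![H₂ 0 0, 0, H₂ 0 1; 0, hW, 0; H₂ 1 0, 0, H₂ 1 1] : Matrix (Fin 3) (Fin 3) E) L₃ ∧
                          L₃ ⊓ LinearMap.ker ((LinearMap.proj (1 : Fin 3) : (Fin 3 → E) →ₗ[E] E).restrictScalars 𝒪[E]) =
                            B.map ((Matrix.toLin' (!![1, 0; 0, 0; 0, 1] : Matrix (Fin 3) (Fin 2) E)).restrictScalars 𝒪[E]) ∧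
                          (∀ c : E, (Pi.single 1 c : Fin 3 → E) ∈ L₃ ↔ Valued.v c ≤ Valued.v ϖ ^ b) ∧
                          (LatticeNearTransvShell ϖ (d % 2) (mstarOfRecord d) ((((endoGL (γ₂, u) : GL (Fin 3) E) : Matrix (Fin 3) (Fin 3) E) - 1)) L₃ ∧
                            {z : E | ∃ y ∈ L₃, Valued.v ((ϖ ^ (mstarOfRecord d))⁻¹ * (z - pairing σ (!![H₂ 0 0, 0, H₂ 0 1; 0, hW, 0; H₂ 1 0, 0, H₂ 1 1] : Matrix (Fin 3) (Fin 3) E) y (((((endoGL (γ₂, u) : GL (Fin 3) E) : Matrix (Fin 3) (Fin 3) E) - 1)) *ᵥ y))) ≤ 1} =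
                              valueSetMod σ ϖ (mstarOfRecord d) (xPlus σ ϖ d)))
    (fun Λ => ∃ B : Submodule 𝒪[E] (Fin 2 → E), B.toAddSubgroup.map φ = Λ ∧
                        ∃ L₃ : Submodule 𝒪[E] (Fin 3 → E), IsSelfDualLattice σ ϖ (!![H₂ 0 0, 0, H₂ 0 1; 0, hW, 0; H₂ 1 0, 0, H₂ 1 1] : Matrix (Fin 3) (Fin 3) E) L₃ ∧
                          L₃ ⊓ LinearMap.ker ((LinearMap.proj (1 : Fin 3) : (Fin 3 → E) →ₗ[E] E).restrictScalars 𝒪[E]) =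
                            B.map ((Matrix.toLin' (!![1, 0; 0, 0; 0, 1] : Matrix (Fin 3) (Fin 2) E)).restrictScalars 𝒪[E]) ∧
                          (∀ c : E, (Pi.single 1 c : Fin 3 → E) ∈ L₃ ↔ Valued.v c ≤ Valued.v ϖ ^ b) ∧
                          (LatticeNearTransvShell ϖ (d % 2) (mcOfRecord d) ((((endoGL (γ₂, u) : GL (Fin 3) E) : Matrix (Fin 3) (Fin 3) E) - 1)) L₃ ∧
                            ¬ {z : E | ∃ y ∈ L₃, Valued.v ((ϖ ^ (mstarOfRecord d))⁻¹ * (z - pairing σ (!![H₂ 0 0, 0, H₂ 0 1; 0, hW, 0; H₂ 1 0, 0, H₂ 1 1] : Matrix (Fin 3) (Fin 3) E) y (((((endoGL (γ₂, u) : GL (Fin 3) E) : Matrix (Fin 3) (Fin 3) E) - 1)) *ᵥ y))) ≤ 1} =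
                              valueSetMod σ ϖ (mstarOfRecord d) (xPlus σ ϖ d)))
    (fun Λ x₀ hG => weight_ne_zero_iff_cls_of_gen hD h2v jE hjv hjfix hΘj hρρ hvρ hΘΘ hΘρ hvΘ hΘh hh hb1 hdb hccA hFgap hhWσ hhW1 hlamj f hf hcellEq Λ x₀ hG)
    (fun Λ x₀ hG hfne => ?_) (fun Λ x₀ hG hfne => ?_) (normSign σ (-hW)) (fun V => normSign σ (α₁ + γ₁ * V))
    (fun V _ _ hNXV => by simp only [hNXV, true_implies]; exact ite_eq_normSign_mul_normSign σ (α₁ + γ₁ * V) (-hW))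
  -- (hL₁): `P₁ Λ ↔ ∃ Ve, jE Ve = Vf x₀ ∧ NX Ve ∧ (NX Ve → LBL Ve)`
  · have hΛ : Λ ∈ levelSetDep ρ Θ α (jE ϖ) h j b (lam - jE ((u : Matrix (Fin 1) (Fin 1) E) 0 0)) := by rw [hcellEq]; exact ⟨x₀, hG⟩
    obtain ⟨Ve, hjVe, hσVe, hVe1⟩ := hV Λ x₀ hG
    refine ⟨?_, ?_⟩
    · rintro ⟨B, hBΛ, L₃, hL, hLB, htube, hsh, hVS⟩
      obtain ⟨hs, -, hl⟩ := hjunc hΛ hBΛ hL hLB htube hfne hG hjVe hσVe hVe1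
      exact ⟨Ve, hjVe, hs.1 hsh, fun hN => (hl hN).1 hVS⟩
    · rintro ⟨Ve', hjVe', hN, hψVe'⟩
      obtain rfl : Ve' = Ve := jE.injective (hjVe'.trans hjVe.symm)
      obtain ⟨B, hBΛ, L₃, hL, hLB, htube⟩ := exists_glued_of_mem_levelSetDep_of_weight_ne_zero σ hσσ hvσ hϖ hH₂ hH₂σ hhW hhWσ jE hρρ hvρ hα hα1 hint hΘΘ hΘρ hvΘ
        hΘj hjv hjfix hjpow hϖmax φ hφs hφi hφo hφγ hvlam hΘh hh hform ((u : Matrix (Fin 1) (Fin 1) E) 0 0) hb1 hlamj f hf hΛ hfne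
      obtain ⟨hs, -, hl⟩ := hjunc hΛ hBΛ hL hLB htube hfne hG hjVe' hσVe hVe1
      exact ⟨B, hBΛ, L₃, hL, hLB, htube, hs.2 hN, (hl hN).2 (hψVe' hN)⟩
  -- (hL₂): `Q₁ Λ ↔ ∃ Ve, jE Ve = Vf x₀ ∧ NX Ve ∧ ¬ (NX Ve → LBL Ve)`
  · have hΛ : Λ ∈ levelSetDep ρ Θ α (jE ϖ) h j b (lam - jE ((u : Matrix (Fin 1) (Fin 1) E) 0 0)) := by rw [hcellEq]; exact ⟨x₀, hG⟩
    obtain ⟨Ve, hjVe, hσVe, hVe1⟩ := hV Λ x₀ hG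
    refine ⟨?_, ?_⟩
    · rintro ⟨B, hBΛ, L₃, hL, hLB, htube, hsh, hVS⟩
      obtain ⟨-, hs, hl⟩ := hjunc hΛ hBΛ hL hLB htube hfne hG hjVe hσVe hVe1
      exact ⟨Ve, hjVe, hs.1 hsh, fun hψ => hVS ((hl (hs.1 hsh)).2 (hψ (hs.1 hsh)))⟩
    · rintro ⟨Ve', hjVe', hN, hψVe'⟩
      obtain rfl : Ve' = Ve := jE.injective (hjVe'.trans hjVe.symm)
      obtain ⟨B, hBΛ, L₃, hL, hLB, htube⟩ := exists_glued_of_mem_levelSetDep_of_weight_ne_zero σ hσσ hvσ hϖ hH₂ hH₂σ hhW hhWσ jE hρρ hvρ hα hα1 hint hΘΘ hΘρ hvΘ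
        hΘj hjv hjfix hjpow hϖmax φ hφs hφi hφo hφγ hvlam hΘh hh hform ((u : Matrix (Fin 1) (Fin 1) E) 0 0) hb1 hlamj f hf hΛ hfne
      obtain ⟨-, hs, hl⟩ := hjunc hΛ hBΛ hL hLB htube hfne hG hjVe' hσVe hVe1
      exact ⟨B, hBΛ, L₃, hL, hLB, htube, hs.2 hN, fun hVS => hψVe' (fun _ => (hl hN).1 hVS)⟩

end Summit.HodgeConjecture.HodgeConjecture.Cruxes.H413.F0P3cDyRamRowTowerTopCellPerCellValue

end
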